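import Literature.Probability.Percolation.TwoClusterConditionalAssociationProofs
import HarnessLib

/-!
# Two sources cut from a common sink have positively correlated clusters
# (a corollary of van den Berg–Häggström–Kahn 2006, Thm. 1.3)

Support file (`--supports stmt-CriticalPhenomena-4575`, closed), prover `prim-lf-2` (gen 29).  No definitions, no named
facts, no sorries; standard axioms.  Memo `prim-lf-2/CW-VDBHK-gen29.md` §8.5.

**Theorem (`twoSource_conditionalAssociation`).**  Bernoulli bond percolation with arbitrary edge probabilities
`p_e = w e` on a finite vertex set (`μ = prodBernoulli w` on `Set (Sym2 V)`), three vertices `z ∉ {x, x'}`, and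
`D = {z ↮ x} ∩ {z ↮ x'}`.  For `F, G : Set (Sym2 V) → ℝ` increasing,
  `(∫_D F(C_x) dμ) · (∫_D G(C_{x'}) dμ) ≤ μ(D) · ∫_D F(C_x) G(C_{x'}) dμ`,
i.e. given that neither `x` nor `x'` is joined to `z`, every increasing function of the open edge cluster of `x` is
positively correlated with every increasing function of the open edge cluster of `x'`.  [cite: VandenbergHaggstromKahn2005, Thm. 1.3 (p. 6) and
Remark 1 after Thm. 1.2 (p. 5: "we could replace s … by sets of vertices")] gives the case of ONE source (or of the
cluster of the SET `{x, x'}`); the two-source form is not printed there but follows by the printed proof of their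
Thm. 1.5 (pp. 7–8) with the roles of source and sink exchanged: condition on `C_z = W` (display (10)); given
`C_z = W` the clusters of `x` and `x'` are those of the fresh configuration with `W̄` deleted, both increasing in it, so
Harris applies; `W ↦ E[F(C_x) | C_z = W]` is decreasing in `W`; and the law of `C_z` on `{z ↮ {x,x'}}` is positively
associated by Thm. 1.3 with `X = {x, x'}` (the tree's PROVED `BHK2006_clusterConditionalPositiveAssociation_holds`).
This is the law-level shadow of prim-lf-2's coefficientwise conjecture CW-POS (memo §8.5; exact census 0 negatives
through all graphs on 6 vertices): written in the finite-sum language of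
`Literature/Probability/Percolation/ConditionalPositiveAssociationProofs.lean` and `…/TwoClusterConditionalAssociationProofs.lean`
(`BHK2006.weight`, `blockFubini`, `harris_anti_anti`, `sum`-form of display (10)).
[cite: KozmaNitzan2024, Questions 8–9 (§5.5 p. 36) (context: the Question-8 pocket covariance programme)]
-/

noncomputable section

open MeasureTheory unitInterval
open Literature.Probability.LatticeModels (prodBernoulli)
open Literature.Probability.Percolation
open Literature.Probability.Percolation.BHK2006

namespace Summit.CriticalPhenomena.PercolationContinuityZ3.Theorems

namespace TwoSource

open scoped Classical
open DecisionTree (ind ind_of_mem ind_of_not_mem ind_nonneg)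

variable {V : Type*} [Fintype V]

/-- `E[F(C_t) | C_s = W] = Σ_η weight(η) F(C_t(η ∖ W̄))` is DECREASING in `W` for increasing `F` (the deleted set
`W̄ = B W` grows with `W`).  [cite: VandenbergHaggstromKahn2005, §1 p. 8 ("stochastically decreasing in `W`")] -/
theorem condAvg_anti {w : Sym2 V → ℝ} (hw0 : ∀ e, 0 ≤ w e) (hw1 : ∀ e, w e ≤ 1) (t : V)
    {B : Set (Sym2 V) → Set (Sym2 V)} (hB : Monotone B) {F : Set (Sym2 V) → ℝ} (hF : Monotone F) :
    Antitone fun W => ∑ η, weight w η * F (openEdgeCluster (η \ B W) t) := by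
  intro W W' hWW'
  refine Finset.sum_le_sum fun η _ => mul_le_mul_of_nonneg_left ?_ (weight_nonneg hw0 hw1 η)
  exact hF (openEdgeCluster_mono (Set.sdiff_subset_sdiff_right (hB hWW')) t)

/-- Harris in the fresh variables off the deleted set `B`: for increasing `F, G` and two targets `t, t'`,
`E[F(C_t)] E[G(C_{t'})] ≤ E[F(C_t) G(C_{t'})]` (both are increasing functions of `η`).
[cite: VandenbergHaggstromKahn2005, §1 p. 8 ("by Harris' inequality")] -/
theorem condAvg_mul_le₂ {w : Sym2 V → ℝ} (hw0 : ∀ e, 0 ≤ w e) (hw1 : ∀ e, w e ≤ 1)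
    (hm : ∑ ω, weight w ω = 1) (t t' : V) (B : Set (Sym2 V)) {F G : Set (Sym2 V) → ℝ}
    (hF : Monotone F) (hG : Monotone G) :
    (∑ η, weight w η * F (openEdgeCluster (η \ B) t)) * ∑ η, weight w η * G (openEdgeCluster (η \ B) t') ≤
      ∑ η, weight w η * (F (openEdgeCluster (η \ B) t) * G (openEdgeCluster (η \ B) t')) := by
  have h := harris_anti_anti hw0 hw1 hm (f := fun η => -F (openEdgeCluster (η \ B) t))
    (g := fun η => -G (openEdgeCluster (η \ B) t'))
    (fun _ _ hab => neg_le_neg (hF (openEdgeCluster_mono (Set.sdiff_subset_sdiff_left hab) t)))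
    (fun _ _ hab => neg_le_neg (hG (openEdgeCluster_mono (Set.sdiff_subset_sdiff_left hab) t')))
    (M := -F ∅) (N := -G ∅)
    (fun _ => neg_le_neg (hF (Set.empty_subset _))) (fun _ => neg_le_neg (hG (Set.empty_subset _)))
  have e1 : ∑ η, weight w η * -F (openEdgeCluster (η \ B) t) = -∑ η, weight w η * F (openEdgeCluster (η \ B) t) := by
    rw [← Finset.sum_neg_distrib]; exact Finset.sum_congr rfl fun η _ => by ring
  have e2 : ∑ η, weight w η * -G (openEdgeCluster (η \ B) t') = -∑ η, weight w η * G (openEdgeCluster (η \ B) t') := by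
    rw [← Finset.sum_neg_distrib]; exact Finset.sum_congr rfl fun η _ => by ring
  have e3 : ∑ η, weight w η * (-F (openEdgeCluster (η \ B) t) * -G (openEdgeCluster (η \ B) t')) =
      ∑ η, weight w η * (F (openEdgeCluster (η \ B) t) * G (openEdgeCluster (η \ B) t')) :=
    Finset.sum_congr rfl fun η _ => by ring
  rw [e1, e2, e3, neg_mul_neg] at h
  exact h

/-- **Display (10) with two targets** (domain Markov property): for any `H`,
`E[H(C_s, C_t, C_{t'}) 1{s ↮ t, s ↮ t'}] = Σ_ω weight(ω) (Σ_η weight(η) H(C_s(ω), C_t(η ∖ W̄), C_{t'}(η ∖ W̄))) 1_D(ω)` with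
`W = C_s(ω)` and `W̄` the pairs meeting `{s} ∪ V(W)`.  [cite: VandenbergHaggstromKahn2005, §1 pp. 7–8, display (10)] -/
theorem sum_cond_cluster₂ (w : Sym2 V → ℝ) (hm : ∑ ω, weight w ω = 1) (s t t' : V)
    (H : Set (Sym2 V) → Set (Sym2 V) → Set (Sym2 V) → ℝ) {D : Set (Set (Sym2 V))}
    (hD : ∀ ω, ω ∈ D ↔ ¬ (openGraph ω).Reachable s t ∧ ¬ (openGraph ω).Reachable s t') :
    ∑ ω, weight w ω * (H (openEdgeCluster ω s) (openEdgeCluster ω t) (openEdgeCluster ω t') * ind D ω) =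
      ∑ ω, weight w ω * ((∑ η, weight w η * H (openEdgeCluster ω s)
        (openEdgeCluster (η \ {e | ∃ v ∈ e, v = s ∨ ∃ e' ∈ openEdgeCluster ω s, v ∈ e'}) t)
        (openEdgeCluster (η \ {e | ∃ v ∈ e, v = s ∨ ∃ e' ∈ openEdgeCluster ω s, v ∈ e'}) t')) * ind D ω) := by
  have key : ∀ W : Set (Sym2 V),
      ∑ ω, (if openEdgeCluster ω s = W then
          weight w ω * (H W (openEdgeCluster ω t) (openEdgeCluster ω t') * ind D ω) else 0) =
      ∑ ω, (if openEdgeCluster ω s = W then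
          weight w ω * ((∑ η, weight w η * H W
            (openEdgeCluster (η \ {e | ∃ v ∈ e, v = s ∨ ∃ e' ∈ W, v ∈ e'}) t)
            (openEdgeCluster (η \ {e | ∃ v ∈ e, v = s ∨ ∃ e' ∈ W, v ∈ e'}) t')) * ind D ω) else 0) := by
    intro W
    by_cases ht : (t = s ∨ ∃ e ∈ W, t ∈ e) ∨ (t' = s ∨ ∃ e ∈ W, t' ∈ e)
    · -- on `{C_s = W}`, `s ↔ t` or `s ↔ t'`: both sides vanish termwise
      refine Finset.sum_congr rfl fun ω _ => ?_
      split_ifs with hW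
      · have hr : (openGraph ω).Reachable s t ∨ (openGraph ω).Reachable s t' := by
          rw [reachable_iff_exists_mem_openEdgeCluster, reachable_iff_exists_mem_openEdgeCluster, hW]; exact ht
        have hnD : ω ∉ D := fun h => by
          rcases hr with hr | hr
          · exact ((hD ω).1 h).1 hr
          · exact ((hD ω).1 h).2 hr
        simp only [ind_of_not_mem hnD, mul_zero]
      · rfl
    · -- block Fubini with the block `A = W̄`
      have ht1' : ¬ (t = s ∨ ∃ e ∈ W, t ∈ e) := fun h => ht (Or.inl h)
      have ht2' : ¬ (t' = s ∨ ∃ e ∈ W, t' ∈ e) := fun h => ht (Or.inr h)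
      set A : Set (Sym2 V) := {e | ∃ v ∈ e, v = s ∨ ∃ e' ∈ W, v ∈ e'} with hA
      set Φ : Set (Sym2 V) → Set (Sym2 V) → ℝ := fun ζ η =>
        if openEdgeCluster ζ s = W then H W (openEdgeCluster (η \ A) t) (openEdgeCluster (η \ A) t') else 0 with hΦ
      have hind : ∀ ω, openEdgeCluster ω s = W → ind D ω = 1 := fun ω hW =>
        ind_of_mem ((hD ω).2 ⟨by rw [reachable_iff_exists_mem_openEdgeCluster, hW]; exact ht1',
          by rw [reachable_iff_exists_mem_openEdgeCluster, hW]; exact ht2'⟩)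
      have h1 : ∀ ω, (if openEdgeCluster ω s = W then
          weight w ω * (H W (openEdgeCluster ω t) (openEdgeCluster ω t') * ind D ω) else 0) =
          weight w ω * Φ (ω ∩ A) (ω \ A) := by
        intro ω
        simp only [hΦ, hA, openEdgeCluster_inter_bar_eq_iff, openEdgeCluster_sdiff_sdiff]
        split_ifs with hW
        · rw [hind ω hW, mul_one, openEdgeCluster_eq_sdiff_bar hW ht1', openEdgeCluster_eq_sdiff_bar hW ht2']
        · rw [mul_zero]
      have h2 : ∀ ω, weight w ω * ∑ ω', weight w ω' * Φ (ω ∩ A) (ω' \ A) =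
          (if openEdgeCluster ω s = W then
            weight w ω * ((∑ η, weight w η * H W (openEdgeCluster (η \ A) t) (openEdgeCluster (η \ A) t')) * ind D ω)
          else 0) := by
        intro ω
        simp only [hΦ, hA, openEdgeCluster_inter_bar_eq_iff, openEdgeCluster_sdiff_sdiff]
        split_ifs with hW
        · rw [hind ω hW, mul_one]
        · simp
      calc ∑ ω, (if openEdgeCluster ω s = W then
              weight w ω * (H W (openEdgeCluster ω t) (openEdgeCluster ω t') * ind D ω) else 0)
          = (∑ ω, weight w ω) * ∑ ω, weight w ω * Φ (ω ∩ A) (ω \ A) := by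
            rw [hm, one_mul]; exact Finset.sum_congr rfl fun ω _ => h1 ω
        _ = ∑ ω, weight w ω * ∑ ω', weight w ω' * Φ (ω ∩ A) (ω' \ A) := blockFubini w A Φ
        _ = _ := Finset.sum_congr rfl fun ω _ => h2 ω
  -- sum over `W`
  calc ∑ ω, weight w ω * (H (openEdgeCluster ω s) (openEdgeCluster ω t) (openEdgeCluster ω t') * ind D ω)
      = ∑ ω, ∑ W, (if openEdgeCluster ω s = W then
          weight w ω * (H W (openEdgeCluster ω t) (openEdgeCluster ω t') * ind D ω) else 0) :=
        Finset.sum_congr rfl fun ω _ => (Fintype.sum_ite_eq (openEdgeCluster ω s)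
          fun W => weight w ω * (H W (openEdgeCluster ω t) (openEdgeCluster ω t') * ind D ω)).symm
    _ = ∑ W, ∑ ω, (if openEdgeCluster ω s = W then
          weight w ω * (H W (openEdgeCluster ω t) (openEdgeCluster ω t') * ind D ω) else 0) := Finset.sum_comm
    _ = ∑ W, ∑ ω, (if openEdgeCluster ω s = W then
          weight w ω * ((∑ η, weight w η * H W
            (openEdgeCluster (η \ {e | ∃ v ∈ e, v = s ∨ ∃ e' ∈ W, v ∈ e'}) t)
            (openEdgeCluster (η \ {e | ∃ v ∈ e, v = s ∨ ∃ e' ∈ W, v ∈ e'}) t')) * ind D ω) else 0) :=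
        Finset.sum_congr rfl fun W _ => key W
    _ = ∑ ω, ∑ W, (if openEdgeCluster ω s = W then
          weight w ω * ((∑ η, weight w η * H W
            (openEdgeCluster (η \ {e | ∃ v ∈ e, v = s ∨ ∃ e' ∈ W, v ∈ e'}) t)
            (openEdgeCluster (η \ {e | ∃ v ∈ e, v = s ∨ ∃ e' ∈ W, v ∈ e'}) t')) * ind D ω) else 0) :=
        Finset.sum_comm
    _ = _ :=
        Finset.sum_congr rfl fun ω _ => Fintype.sum_ite_eq (openEdgeCluster ω s)
          fun W => weight w ω * ((∑ η, weight w η * H W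
            (openEdgeCluster (η \ {e | ∃ v ∈ e, v = s ∨ ∃ e' ∈ W, v ∈ e'}) t)
            (openEdgeCluster (η \ {e | ∃ v ∈ e, v = s ∨ ∃ e' ∈ W, v ∈ e'}) t')) * ind D ω)

end TwoSource

open TwoSource DecisionTree in
/-- **Two sources cut from a common sink are positively correlated.**  For Bernoulli bond percolation with arbitrary
edge probabilities `w` on a finite vertex set, vertices `x ≠ z`, `x' ≠ z`, increasing `F, G : Set (Sym2 V) → ℝ` and
`D = {z ↮ x} ∩ {z ↮ x'}`:  `(∫_D F(C_x))(∫_D G(C_{x'})) ≤ μ(D) · ∫_D F(C_x) G(C_{x'})`, i.e.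
`E[F(C_x) G(C_{x'}) | z ↮ {x,x'}] ≥ E[F(C_x) | z ↮ {x,x'}] · E[G(C_{x'}) | z ↮ {x,x'}]`.
Proof (van den Berg–Häggström–Kahn's proof of their Thm. 1.5 with source and sink exchanged): condition on `C_z = W`
(`TwoSource.sum_cond_cluster₂`); Harris in the fresh variables off `W̄` (`TwoSource.condAvg_mul_le₂`);
`W ↦ E[F(C_x) | C_z = W]` is decreasing (`TwoSource.condAvg_anti`); Thm. 1.3 with `X = {x, x'}`
(`BHK2006_clusterConditionalPositiveAssociation_holds`) for the two decreasing functions of `C_z`.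
[cite: VandenbergHaggstromKahn2005, Thm. 1.3 (p. 6), Thm. 1.5 and its proof (pp. 7–8)]
[cite: KozmaNitzan2024, Questions 8–9 (§5.5 p. 36) (context)] -/
theorem twoSource_conditionalAssociation {V : Type} [Fintype V] (w : Sym2 V → unitInterval) (z x x' : V)
    (F G : Set (Sym2 V) → ℝ) (hF : Monotone F) (hG : Monotone G) (hx : x ≠ z) (hx' : x' ≠ z) :
    (∫ ω in {ω : BondConfig V | ¬ (openGraph ω).Reachable z x ∧ ¬ (openGraph ω).Reachable z x'},
        F (openEdgeCluster ω x) ∂(prodBernoulli w)) *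
      (∫ ω in {ω : BondConfig V | ¬ (openGraph ω).Reachable z x ∧ ¬ (openGraph ω).Reachable z x'},
        G (openEdgeCluster ω x') ∂(prodBernoulli w)) ≤
    (prodBernoulli w).real {ω : BondConfig V | ¬ (openGraph ω).Reachable z x ∧ ¬ (openGraph ω).Reachable z x'} *
      ∫ ω in {ω : BondConfig V | ¬ (openGraph ω).Reachable z x ∧ ¬ (openGraph ω).Reachable z x'},
        F (openEdgeCluster ω x) * G (openEdgeCluster ω x') ∂(prodBernoulli w) := by
  classical
  set D : Set (BondConfig V) := {ω | ¬ (openGraph ω).Reachable z x ∧ ¬ (openGraph ω).Reachable z x'} with hD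
  have hDmem : ∀ ω, ω ∈ D ↔ ¬ (openGraph ω).Reachable z x ∧ ¬ (openGraph ω).Reachable z x' :=
    fun ω => by rw [hD]; rfl
  have hDm : MeasurableSet D := MeasurableSet.of_discrete
  set w' : Sym2 V → ℝ := fun e => (w e : ℝ) with hw'
  have hw0 : ∀ e, 0 ≤ w' e := fun e => (w e).2.1
  have hw1 : ∀ e, w' e ≤ 1 := fun e => (w e).2.2
  have hint : ∀ h : Set (Sym2 V) → ℝ,
      ∫ ω in D, h ω ∂(prodBernoulli w) = ∑ ω, weight w' ω * (h ω * ind D ω) := by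
    intro h
    rw [← integral_indicator hDm, integral_prodBernoulli_eq_sum]
    refine Finset.sum_congr rfl fun ω _ => ?_
    by_cases hω : ω ∈ D
    · rw [Set.indicator_of_mem hω, ind_of_mem hω, mul_one]
    · rw [Set.indicator_of_notMem hω, ind_of_not_mem hω]; ring
  have hreal : (prodBernoulli w).real D = ∑ ω, weight w' ω * ind D ω := by
    rw [← integral_indicator_one hDm, integral_prodBernoulli_eq_sum]
    refine Finset.sum_congr rfl fun ω _ => ?_
    by_cases hω : ω ∈ D
    · rw [Set.indicator_of_mem hω, ind_of_mem hω, Pi.one_apply]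
    · rw [Set.indicator_of_notMem hω, ind_of_not_mem hω, mul_zero]
  have hm : ∑ ω, weight w' ω = 1 := by
    have h1 := integral_prodBernoulli_eq_sum w fun _ => (1 : ℝ)
    simp only [integral_const, probReal_univ, smul_eq_mul, mul_one] at h1
    exact h1.symm
  -- `E[F(C_x) | C_z = W]`, `E[G(C_x') | C_z = W]` are DECREASING in `W`; Theorem 1.3 with `X = {x, x'}` for their negatives
  set aF : Set (Sym2 V) → ℝ := fun W => ∑ η, weight w' η *
      F (openEdgeCluster (η \ {e | ∃ v ∈ e, v = z ∨ ∃ e' ∈ W, v ∈ e'}) x) with haF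
  set aG : Set (Sym2 V) → ℝ := fun W => ∑ η, weight w' η *
      G (openEdgeCluster (η \ {e | ∃ v ∈ e, v = z ∨ ∃ e' ∈ W, v ∈ e'}) x') with haG
  have hf₁ : Antitone aF := condAvg_anti hw0 hw1 x (bar_mono z) hF
  have hg₁ : Antitone aG := condAvg_anti hw0 hw1 x' (bar_mono z) hG
  have h13 := BHK2006_clusterConditionalPositiveAssociation_holds V w z ({x, x'} : Set V)
    (fun W => -aF W) (fun W => -aG W) hf₁.neg hg₁.neg (by
      simp only [Set.mem_insert_iff, Set.mem_singleton_iff, not_or]; exact ⟨hx.symm, hx'.symm⟩)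
  have hDt : {ω : BondConfig V | ∀ y ∈ ({x, x'} : Set V), ¬ (openGraph ω).Reachable z y} = D := by
    ext ω
    simp only [Set.mem_setOf_eq, Set.mem_insert_iff, Set.mem_singleton_iff, forall_eq_or_imp, forall_eq, hDmem]
  rw [hDt] at h13
  rw [hint, hint, hint (fun ω => -aF (openEdgeCluster ω z) * -aG (openEdgeCluster ω z)), hreal] at h13
  have n1 : ∑ ω, weight w' ω * (-aF (openEdgeCluster ω z) * ind D ω) = -∑ ω, weight w' ω * (aF (openEdgeCluster ω z) * ind D ω) := by
    rw [← Finset.sum_neg_distrib]; exact Finset.sum_congr rfl fun ω _ => by ring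
  have n2 : ∑ ω, weight w' ω * (-aG (openEdgeCluster ω z) * ind D ω) = -∑ ω, weight w' ω * (aG (openEdgeCluster ω z) * ind D ω) := by
    rw [← Finset.sum_neg_distrib]; exact Finset.sum_congr rfl fun ω _ => by ring
  have n3 : ∑ ω, weight w' ω * (-aF (openEdgeCluster ω z) * -aG (openEdgeCluster ω z) * ind D ω) =
      ∑ ω, weight w' ω * (aF (openEdgeCluster ω z) * aG (openEdgeCluster ω z) * ind D ω) :=
    Finset.sum_congr rfl fun ω _ => by ring
  rw [n1, n2, n3, neg_mul_neg] at h13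
  -- the three integrals of the goal, conditioned on `C_z` (display (10) with two targets)
  rw [hint (fun ω => F (openEdgeCluster ω x)), hint (fun ω => G (openEdgeCluster ω x')),
    hint (fun ω => F (openEdgeCluster ω x) * G (openEdgeCluster ω x')), hreal]
  have e1 := sum_cond_cluster₂ w' hm z x x' (fun _ C _ => F C) hDmem
  have e2 := sum_cond_cluster₂ w' hm z x x' (fun _ _ C' => G C') hDmem
  have e3 := sum_cond_cluster₂ w' hm z x x' (fun _ C C' => F C * G C') hDmem
  -- Harris on each `{C_z = W}`
  have hH : ∑ ω, weight w' ω * (aF (openEdgeCluster ω z) * aG (openEdgeCluster ω z) * ind D ω) ≤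
      ∑ ω, weight w' ω * ((∑ η, weight w' η *
        (F (openEdgeCluster (η \ {e | ∃ v ∈ e, v = z ∨ ∃ e' ∈ openEdgeCluster ω z, v ∈ e'}) x) *
         G (openEdgeCluster (η \ {e | ∃ v ∈ e, v = z ∨ ∃ e' ∈ openEdgeCluster ω z, v ∈ e'}) x'))) * ind D ω) :=
    Finset.sum_le_sum fun ω _ => mul_le_mul_of_nonneg_left
      (mul_le_mul_of_nonneg_right (condAvg_mul_le₂ hw0 hw1 hm x x' _ hF hG) (ind_nonneg _ _))
      (weight_nonneg hw0 hw1 ω)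
  have hP : 0 ≤ ∑ ω, weight w' ω * ind D ω :=
    Finset.sum_nonneg fun ω _ => mul_nonneg (weight_nonneg hw0 hw1 ω) (ind_nonneg _ _)
  show (∑ ω, weight w' ω * (F (openEdgeCluster ω x) * ind D ω)) *
      (∑ ω, weight w' ω * (G (openEdgeCluster ω x') * ind D ω)) ≤
    (∑ ω, weight w' ω * ind D ω) *
      ∑ ω, weight w' ω * (F (openEdgeCluster ω x) * G (openEdgeCluster ω x') * ind D ω)
  rw [e1, e2, e3]
  exact h13.trans (mul_le_mul_of_nonneg_left hH hP)

end Summit.CriticalPhenomena.PercolationContinuityZ3.Theorems
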